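import Summits.Parity.GeneralizedHardyLittlewood.Theorems.GreenTaoLevelTwoGITwoCyclicInverseLocalLinearPhaseCorr
import Summits.Parity.GeneralizedHardyLittlewood.Theorems.GreenTaoLevelTwoGITwoCyclicInverseSymmetry

/-!
# Route `GreenTaoLevelTwo`, crux `GITwo` (stmt-Parity-21275), line `birth`, stub `stub_cyclicInverse`:
# C13 assembly, step 1: the derivative-correlation input (eq9.72) with a NONEMPTY frequency set

Seventy-ninth helper file toward the XL stub `stub_cyclicInverse` (B. Green, T. Tao, *An inverse
theorem for the Gowers `U³(G)` norm*, arXiv:math/0503014, Thm. 68 = PEMS 51 (2008) Thm. 12.8).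
Block C13 (assembly of §9): arXiv Prop. 45 (`exists_locally_linear_correlation`) delivers the
regular Bohr set `B₁ = B(Spec,ρ)`, the locally additive `μ` and the averaged correlation of the
derivatives in `dftCoeff` form; `symmetry_of_derivative` (arXiv Lemma 46) and the §9 Step 3 lemmas
consume the sum form (eq9.72) `κ N #B₁ ≤ Σ_{h∈B₁} |Σ_x c₂(x+h) c₃(x) e(−μ(h)x/N)|` with `1`-bounded
weights AND a nonempty frequency set (all their constants divide by `#S`).  This def-free file
performs the conversion (`norm_sum_deriv_eq_mul_norm_dftCoeff`) and disposes of `Spec = ∅` by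
replacing it with `{0}` (all Bohr sets over `∅` and over `{0}` are the whole group):

* `bohr_zero_eq` — `B({0},r) = univ = B(∅,r)` for `r > 0`;
* `exists_derivative_correlation_input` — from `|f| ≤ 1`, `ε ≤ ‖f‖⁸_{U³}`: a NONEMPTY `S` with
  `#S ≤ C(ε)`, `ρ ∈ [1/16,1/8]` with `B(S,ρ)` regular, `μ` additive on `B(S,¼)`, points `x₀ ξ₀`, and
  (eq9.72) with `κ = ε¹⁷ 2⁻²³ 128^{-d} √(ε/2)` for the weights `c₂ = f(·+x₀)`, `c₃ = f·e(−·ξ₀/N)`.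

References: [GreenTao2008U3Inverse] arXiv:math/0503014, Prop. 45 and §9 (eq9.72).
-/

noncomputable section

namespace Summit.Parity.GeneralizedHardyLittlewood.GreenTaoLevelTwoGITwoCyclicInverse

open Finset ZMod
open Literature.NumberTheory.Sieve

variable {M : ℕ} [NeZero M]

/-- Over the frequency set `{0}` every Bohr set of positive radius is the whole group. [folklore] -/
theorem bohr_zero_eq {r : ℝ} (hr : 0 < r) :
    ({x : ZMod M | ∀ ξ ∈ ({0} : Finset (ZMod M)), ‖ZMod.toAddCircle (x * ξ)‖ < r} : Finset (ZMod M)) =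
      Finset.univ := by
  ext x
  simp only [mem_filter, mem_univ, true_and, mem_singleton, forall_eq, mul_zero, map_zero,
    norm_zero, iff_true]
  exact hr

/-- Over the empty frequency set every Bohr set is the whole group. [folklore] -/
theorem bohr_empty_eq (r : ℝ) :
    ({x : ZMod M | ∀ ξ ∈ (∅ : Finset (ZMod M)), ‖ZMod.toAddCircle (x * ξ)‖ < r} : Finset (ZMod M)) =
      Finset.univ := by
  ext x
  simp

/-- **(eq9.72) with a nonempty frequency set.**  Let `N` be prime, `|f| ≤ 1`, `0 < ε ≤ ‖f‖⁸_{U³}`.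
There are a nonempty `S ⊆ ℤ/Nℤ`, `d : ℕ`, `ρ ∈ [1/16,1/8]`, a map `μ` and points `x₀, ξ₀` with:
`d ≤ (2²²⁵/ε¹⁶⁸)¹⁷`, `#S ≤ max 1 (4·(128^d·2²³/ε¹⁷)³)` is not asserted — instead the raw bounds of
arXiv Prop. 45 are passed on (`#S · (β³/4) ≤ β` with `β ≥ ε¹⁷/(2²³128^d)`, or `#S = 1`); `B(S,ρ)`
regular; `μ` additive on `B(S,¼)`; and
`κ N #B(S,ρ) ≤ Σ_{h∈B(S,ρ)} ‖Σ_x f(x+h+x₀) (f(x)e(−xξ₀/N)) e(−μ(h)x/N)‖`, `κ = ε¹⁷2⁻²³128^{-d}√(ε/2)`.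
[cite: GreenTao2008U3Inverse, Prop. 45 and §9 (eq9.72)] -/
theorem exists_derivative_correlation_input (hM : M.Prime) {f : ZMod M → ℝ} (hf : ∀ x, |f x| ≤ 1)
    {ε : ℝ} (hε0 : 0 < ε) (hε : ε ≤ gowersPower 3 f) :
    ∃ (S : Finset (ZMod M)) (μ : ZMod M → ZMod M) (d : ℕ) (ρ β : ℝ) (x₀ ξ₀ : ZMod M),
      S.Nonempty ∧ (d : ℝ) ≤ (2 ^ 225 / ε ^ 168) ^ 17 ∧
      ε ^ 17 / 2 ^ 23 / (128 : ℝ) ^ d ≤ β ∧ β ≤ 1 ∧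
      (S = {0} ∨ (#S : ℝ) * (β ^ 3 / 4) ≤ β) ∧
      1 / 16 ≤ ρ ∧ ρ ≤ 1 / 8 ∧
      (∀ r : ℝ, |r| ≤ 1 / (100 * (#S : ℝ)) →
        (1 - 100 * (#S : ℝ) * |r|) * #{x : ZMod M | ∀ ξ ∈ S, ‖ZMod.toAddCircle (x * ξ)‖ < ρ} ≤
            #{x : ZMod M | ∀ ξ ∈ S, ‖ZMod.toAddCircle (x * ξ)‖ < (1 + r) * ρ} ∧
          (#{x : ZMod M | ∀ ξ ∈ S, ‖ZMod.toAddCircle (x * ξ)‖ < (1 + r) * ρ} : ℝ) ≤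
            (1 + 100 * (#S : ℝ) * |r|) * #{x : ZMod M | ∀ ξ ∈ S, ‖ZMod.toAddCircle (x * ξ)‖ < ρ}) ∧
      (∀ h₁ h₂ : ZMod M, (∀ ξ' ∈ S, ‖ZMod.toAddCircle (h₁ * ξ')‖ ≤ 1 / 4) →
        (∀ ξ' ∈ S, ‖ZMod.toAddCircle (h₂ * ξ')‖ ≤ 1 / 4) →
        (∀ ξ' ∈ S, ‖ZMod.toAddCircle ((h₁ + h₂) * ξ')‖ ≤ 1 / 4) → μ (h₁ + h₂) = μ h₁ + μ h₂) ∧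
      ε ^ 17 / 2 ^ 23 / (128 : ℝ) ^ d * Real.sqrt (ε / 2) * M *
          #{x : ZMod M | ∀ ξ ∈ S, ‖ZMod.toAddCircle (x * ξ)‖ < ρ} ≤
        ∑ h ∈ ({x : ZMod M | ∀ ξ ∈ S, ‖ZMod.toAddCircle (x * ξ)‖ < ρ} : Finset (ZMod M)),
          ‖∑ x : ZMod M, ((f (x + h + x₀) : ℝ) : ℂ) * (((f x : ℝ) : ℂ) * stdAddChar (-(x * ξ₀))) *
            stdAddChar (-(μ h * x))‖ := by
  classical
  have hMpos : (0 : ℝ) < M := by exact_mod_cast Nat.pos_of_ne_zero (NeZero.ne M)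
  obtain ⟨H'', Spec, μ, d, ρ, x₀, ξ₀, hd, hH, hSpec, hρ1, hρ2, hreg, hadd, hcorr⟩ :=
    exists_locally_linear_correlation hM hf hε0 hε
  set β : ℝ := (#H'' : ℝ) / M with hβ
  have hβlo : ε ^ 17 / 2 ^ 23 / (128 : ℝ) ^ d ≤ β := by
    rw [hβ, le_div_iff₀ hMpos]
    have e : ε ^ 17 / 2 ^ 23 / (128 : ℝ) ^ d * M = ε ^ 17 / 2 ^ 23 * M / (128 : ℝ) ^ d := by ring
    rw [e]; exact hH
  have hβ1 : β ≤ 1 := by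
    rw [hβ, div_le_one hMpos]
    exact_mod_cast (card_le_univ H'').trans_eq (ZMod.card M)
  have hρ0 : 0 < ρ := by linarith
  -- convert the `dftCoeff` sum into the (eq9.72) sum (the same for any frequency set)
  have hconv : ∀ B : Finset (ZMod M),
      ε ^ 17 / 2 ^ 23 / (128 : ℝ) ^ d * Real.sqrt (ε / 2) * #B ≤
        ∑ h ∈ B, ‖dftCoeff (fun y => f y * f (y + (x₀ + h))) (ξ₀ + μ h)‖ →
      ε ^ 17 / 2 ^ 23 / (128 : ℝ) ^ d * Real.sqrt (ε / 2) * M * #B ≤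
        ∑ h ∈ B, ‖∑ x : ZMod M, ((f (x + h + x₀) : ℝ) : ℂ) *
          (((f x : ℝ) : ℂ) * stdAddChar (-(x * ξ₀))) * stdAddChar (-(μ h * x))‖ := by
    intro B hB
    have e : ∑ h ∈ B, ‖∑ x : ZMod M, ((f (x + h + x₀) : ℝ) : ℂ) *
        (((f x : ℝ) : ℂ) * stdAddChar (-(x * ξ₀))) * stdAddChar (-(μ h * x))‖ =
        M * ∑ h ∈ B, ‖dftCoeff (fun y => f y * f (y + (x₀ + h))) (ξ₀ + μ h)‖ := by
      rw [mul_sum]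
      exact sum_congr rfl fun h _ => norm_sum_deriv_eq_mul_norm_dftCoeff f x₀ ξ₀ h μ
    rw [e]
    have := mul_le_mul_of_nonneg_left hB hMpos.le
    linarith
  by_cases hS : Spec.Nonempty
  · exact ⟨Spec, μ, d, ρ, β, x₀, ξ₀, hS, hd, hβlo, hβ1, Or.inr hSpec, hρ1, hρ2, hreg, hadd,
      hconv _ hcorr⟩
  · -- `Spec = ∅`: use `S = {0}`, all Bohr sets being the whole group in both cases
    rw [not_nonempty_iff_eq_empty] at hS
    subst hS
    refine ⟨{0}, μ, d, ρ, β, x₀, ξ₀, singleton_nonempty 0, hd, hβlo, hβ1, Or.inl rfl, hρ1, hρ2,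
      fun r hr => ?_, fun h₁ h₂ _ _ _ => hadd h₁ h₂ (by simp) (by simp) (by simp), ?_⟩
    · have hr' : |r| ≤ 1 / 100 := by simpa using hr
      have h1 : 0 < (1 + r) * ρ := by
        have : -1/100 ≤ r := by linarith [abs_le.1 hr']
        nlinarith
      rw [bohr_zero_eq hρ0, bohr_zero_eq h1]
      have hc : (0 : ℝ) ≤ #(univ : Finset (ZMod M)) := Nat.cast_nonneg _
      constructor
      · simp only [card_singleton, Nat.cast_one, mul_one]
        nlinarith [abs_nonneg r]
      · simp only [card_singleton, Nat.cast_one, mul_one]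
        nlinarith [abs_nonneg r]
    · rw [bohr_zero_eq hρ0]
      have h := hconv univ (by rw [← bohr_empty_eq (M := M) ρ]; exact hcorr)
      exact h

end Summit.Parity.GeneralizedHardyLittlewood.GreenTaoLevelTwoGITwoCyclicInverse
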